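import Summits.Ventures.QEC.Thresholds.CSSFamilyThresholds
import Literature.InformationTheory.QuantumCodes.TwistedToricErasureHalfPolynomial
import HarnessLib

/-!
# Loss threshold EXACTLY `1/2` for the twisted / rotated / dilated toric families — Q5 census packaging (KERNEL)

Venture QEC, `Summits/Ventures/QEC/Thresholds/` (LADDER-QEC rung Q5; qec-type-03 gen 5). HONEST FRAMING: every statement is an
UNCONDITIONAL kernel theorem (axioms `propext`, `Classical.choice`, `Quot.sound`; no named fact, no `native_decide`). This file
only INSTANTIATES, in the cell's census vocabulary (`zErasureFamily` / `xErasureFamily` of `CSSFamilyThresholds.lean`, which unfold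
to the loss-uncorrectability families), the Literature theorems of `TwistedToricErasureHalf{,Polynomial}.lean` (cited, not
restated):

| family (census objects) | `Z` sector | `X` sector | Literature source |
|---|---|---|---|
| any twisted tori `code (g₁ i) (g₂ i)` with generating pair, `|G_i| ≤ A sys₁^m`, `sys₁ → ∞` | `twistedToric_z_erasure_accuracyThreshold_eq_half` | `twistedToric_x_erasure_accuracyThreshold_eq_half` | `TwistedToric.twistedToric_loss_accuracyThreshold_eq_half_of_systole` |
| Kovalev–Pryadko rotated codes `[[d²+1, 2, d]]` = `code ((2t+1 : ZMod (2t²+2t+1))) 1` (`rotated_isCode`; t = 1, 2, 3: `[[10,2,3]]`, `[[26,2,5]]`, `[[50,2,7]]`) | `rotatedToric_z_erasure_accuracyThreshold_eq_half` | `rotatedToric_x_…` | `TwistedToric.rotatedToric_loss_accuracyThreshold_eq_half` |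
| Kovalev–Pryadko dilated family `[[2n²c_t, 2, n(2t+1)]]` = `code ((1, 2t+1) : ℤ_n × ℤ_{nc_t}) (0, 1)` at fixed `t`, `n → ∞` (t = 1, n = 2, 3: the census objects `[[40,2,6]]`, `[[90,2,9]]` of `dilated_isCode_40/90`) | `dilatedToric_z_erasure_accuracyThreshold_eq_half` | `dilatedToric_x_…` | `TwistedToric.dilatedToric_loss_accuracyThreshold_eq_half` |

All floors come from Kesten's theorem `p_c(ℤ²) = 1/2` + subcritical sharpness (PROVED in the tree, `Kesten1980_expDecay`) through
the periodic-lift schema; all ceilings from the abelian two-block no-cloning bound (`AbelianTwoBlock.erasure_threshold_le_half`).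

## References

* [StaceBarrettDoherty2009] T. M. Stace, S. D. Barrett, A. C. Doherty, PRL 102 (2009) 200501, p. 1 («the maximum tolerable loss
  rate is 50%»), p. 2–3.
* [KovalevPryadko2013Hyperbicycle] A. A. Kovalev, L. P. Pryadko, PRA 88 (2013) 012311, §III.B Ex. 2 (rotated `[[t²+(t+1)², …]]`
  doubled: `[[2t²+2(t+1)², 2, 2t+1]]`), §IV Ex. 7 (`[[2n²c, 2, nχ]]`, `[[40,2,6]]`, `[[90,2,9]]`).
* [KestenCMP1980] H. Kesten, Comm. Math. Phys. 74 (1980) 41–59, Thm. 1–2.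
-/

noncomputable section

namespace Summit.Ventures.QEC.Thresholds

open Filter Topology
open Literature.InformationTheory.QuantumCodes
open Literature.InformationTheory.QuantumCodes.TwistedToric

/-! ### General census form -/

/-- ★ **`Z` sector, census form**: twisted tori with generating pair and polynomial volume in the systole have loss threshold
EXACTLY `1/2`. [cite: StaceBarrettDoherty2009, p. 1 (abstract)] -/
theorem twistedToric_z_erasure_accuracyThreshold_eq_half {Gs : ℕ → Type*} [∀ i, AddCommGroup (Gs i)]
    [∀ i, DecidableEq (Gs i)] [∀ i, Fintype (Gs i)] (g₁ g₂ : ∀ i, Gs i)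
    (hgen : ∀ i (x : Gs i), ∃ m : ℤ × ℤ, m.1 • g₁ i + m.2 • g₂ i = x) {A : ℝ} {m : ℕ}
    (hcard : ∀ i, (Fintype.card (Gs i) : ℝ) ≤ A * (systole (g₁ i) (g₂ i) : ℝ) ^ m)
    (hsys : Tendsto (fun i => systole (g₁ i) (g₂ i)) atTop atTop) :
    accuracyThreshold (zErasureFamily (fun i => code (g₁ i) (g₂ i))) = 1 / 2 :=
  twistedToric_loss_accuracyThreshold_eq_half_of_systole g₁ g₂ hgen hcard hsys

/-- ★ **`X` sector, census form**: the same families have `X`-loss threshold EXACTLY `1/2`.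
[cite: StaceBarrettDoherty2009, p. 1 (abstract), p. 2 (both logical operators)] -/
theorem twistedToric_x_erasure_accuracyThreshold_eq_half {Gs : ℕ → Type*} [∀ i, AddCommGroup (Gs i)]
    [∀ i, DecidableEq (Gs i)] [∀ i, Fintype (Gs i)] (g₁ g₂ : ∀ i, Gs i)
    (hgen : ∀ i (x : Gs i), ∃ m : ℤ × ℤ, m.1 • g₁ i + m.2 • g₂ i = x) {A : ℝ} {m : ℕ}
    (hcard : ∀ i, (Fintype.card (Gs i) : ℝ) ≤ A * (systole (g₁ i) (g₂ i) : ℝ) ^ m)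
    (hsys : Tendsto (fun i => systole (g₁ i) (g₂ i)) atTop atTop) :
    accuracyThreshold (xErasureFamily (fun i => code (g₁ i) (g₂ i))) = 1 / 2 :=
  twistedToric_x_loss_accuracyThreshold_eq_half_of_systole g₁ g₂ hgen hcard hsys

/-! ### The rotated codes `[[d²+1, 2, d]]` -/

/-- ★ Census form, `Z` sector: Kovalev–Pryadko's rotated toric codes `code (2t+1 : ℤ_{2t²+2t+1}) 1` (`[[d²+1, 2, d]]`,
`d = 2t+1`) have loss threshold EXACTLY `1/2`. [cite: KovalevPryadko2013Hyperbicycle, §III.B Ex. 2] [cite: StaceBarrettDoherty2009, p. 1] -/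
theorem rotatedToric_z_erasure_accuracyThreshold_eq_half :
    accuracyThreshold (zErasureFamily (fun t =>
      code (((2 * t + 1 : ℕ) : ℤ) : ZMod (2 * t ^ 2 + 2 * t + 1)) (1 : ZMod (2 * t ^ 2 + 2 * t + 1)))) = 1 / 2 :=
  rotatedToric_loss_accuracyThreshold_eq_half

/-- ★ Census form, `X` sector of the rotated toric codes: EXACTLY `1/2`.
[cite: KovalevPryadko2013Hyperbicycle, §III.B Ex. 2] [cite: StaceBarrettDoherty2009, p. 1] -/
theorem rotatedToric_x_erasure_accuracyThreshold_eq_half :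
    accuracyThreshold (xErasureFamily (fun t =>
      code (((2 * t + 1 : ℕ) : ℤ) : ZMod (2 * t ^ 2 + 2 * t + 1)) (1 : ZMod (2 * t ^ 2 + 2 * t + 1)))) = 1 / 2 :=
  rotatedToric_x_loss_accuracyThreshold_eq_half

/-! ### The dilated family `[[2n²c_t, 2, n(2t+1)]]` at fixed twist (through the census objects `[[40,2,6]]`, `[[90,2,9]]`) -/

/-- ★ Census form, `Z` sector: for every `t`, the dilated rotated family `code ((1, 2t+1) : ℤ_{n+1} × ℤ_{(n+1)c_t}) (0, 1)`,
`n = 0, 1, 2, …` (`t = 1`: `[[10,2,3]]`, `[[40,2,6]]`, `[[90,2,9]]`, …) has loss threshold EXACTLY `1/2`.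
[cite: KovalevPryadko2013Hyperbicycle, §IV Ex. 7 ([[2n²c, 2, nχ]])] [cite: StaceBarrettDoherty2009, p. 1] -/
theorem dilatedToric_z_erasure_accuracyThreshold_eq_half (t : ℕ) :
    accuracyThreshold (zErasureFamily (fun n =>
      code ((1 : ZMod (n + 1)), ((((2 * t + 1 : ℕ) : ℤ)) : ZMod ((n + 1) * (2 * t ^ 2 + 2 * t + 1))))
        ((0 : ZMod (n + 1)), (1 : ZMod ((n + 1) * (2 * t ^ 2 + 2 * t + 1)))))) = 1 / 2 :=
  dilatedToric_loss_accuracyThreshold_eq_half_fixed_twist t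

/-- ★ Census form, `X` sector of the dilated family at fixed twist: EXACTLY `1/2`.
[cite: KovalevPryadko2013Hyperbicycle, §IV Ex. 7] [cite: StaceBarrettDoherty2009, p. 1] -/
theorem dilatedToric_x_erasure_accuracyThreshold_eq_half (t : ℕ) :
    accuracyThreshold (xErasureFamily (fun n =>
      code ((1 : ZMod (n + 1)), ((((2 * t + 1 : ℕ) : ℤ)) : ZMod ((n + 1) * (2 * t ^ 2 + 2 * t + 1))))
        ((0 : ZMod (n + 1)), (1 : ZMod ((n + 1) * (2 * t ^ 2 + 2 * t + 1)))))) = 1 / 2 := by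
  refine dilatedToric_x_loss_accuracyThreshold_eq_half (fun n => n) (fun _ => t) ?_
  refine tendsto_atTop_mono (fun n => ?_) tendsto_id
  exact le_trans (Nat.le_succ n) (Nat.le_mul_of_pos_right (n + 1) (by omega))

/-- The `t = 1`, `n + 1 = 2` member of the dilated family IS the census object `[[40, 2, 6]]` of
`TwistedToric.dilated_isCode_40` (`code ((1,3) : ZMod 2 × ZMod 10) (0,1)`), definitionally.
[cite: KovalevPryadko2013Hyperbicycle, §IV Ex. 7 ([[40,2,6]])] -/
theorem dilatedToric_one_one_eq :
    code ((1 : ZMod (1 + 1)), ((((2 * 1 + 1 : ℕ) : ℤ)) : ZMod ((1 + 1) * (2 * 1 ^ 2 + 2 * 1 + 1))))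
        ((0 : ZMod (1 + 1)), (1 : ZMod ((1 + 1) * (2 * 1 ^ 2 + 2 * 1 + 1)))) =
      code ((1, 3) : ZMod 2 × ZMod 10) (0, 1) := rfl

end Summit.Ventures.QEC.Thresholds
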